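import Summits.NavierStokesRegularity.NavierStokesRegularity.Theorems.PerpetualPumpAveragedTypeIBlowupPreBootModes
import Summits.NavierStokesRegularity.NavierStokesRegularity.Theorems.PerpetualPumpAveragedTypeIBlowupPreBootRegime
import Summits.NavierStokesRegularity.NavierStokesRegularity.Theorems.PerpetualPumpAveragedTypeIBlowupIncubation
import Summits.NavierStokesRegularity.NavierStokesRegularity.Theorems.PerpetualPumpAveragedTypeIBlowupTrailPairTools

/-!
# Crux `PerpetualPump.AveragedTypeIBlowup` (stmt-NavierStokesRegularity-1835), line `Sketch`:
# stub `preBoot` — the front pair on a pre-ignition horizon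

Fifth file of the proof of the registered stub `stub_preBoot`. On a pre-ignition horizon
`[t₀, S]` (`0 < R_n(S − t₀) ≤ 3`, `w_n² ≤ b_n/100`) the front pair satisfies the conclusions of
`stub_incubation` read in real time (`preBoot_front`, registered tools sub-goal): positivity of
the bond, the carrier envelope `B e^{-σ} − 3/2 ≤ b_n ≤ B e^{-σ} + 5/2`, the bond majorant, the
carrier majorant `≤ 6(B+3)` (from its Duhamel restart inequality, `trailPair_majorant_le`), the
transfer budget `R_n ∫ w_n² ≤ 1/100` and the ignition-budget inequalities NEW-1 / NEW-2
(`Φ₁ = 2` from the loose dump of the previous bond, `θ₀ = 1/10`, `μ₀ = 2B`, `μ₁ = Fε̄B`).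

## References

T. Tao, *Finite time blowup for an averaged three-dimensional Navier–Stokes equation*, J. Amer.
Math. Soc. 29 (2016), 601–674, §5–6 (the cascade / circuit heuristics); the estimates are
folklore ODE bookkeeping.
-/

noncomputable section

-- the summit namespace `…NavierStokesRegularity.NavierStokesRegularity…` is the tree convention
set_option linter.dupNamespace false

open Set MeasureTheory Filter Topology

namespace Summit.NavierStokesRegularity.NavierStokesRegularity.Theorems.PerpetualPumpAveragedTypeIBlowup
set_option maxHeartbeats 800000 in
/-- **The front pair on a pre-ignition horizon under the loose induction hypothesis.** On
`[t₀, S]` (`0 < R_n(S − t₀) ≤ 3`, no ignition `w_n² ≤ b_n/100`): from the loose level-1 carrier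
(`|b_{n+1}| ≤ 1/2`) and the loose previous bond (`w_{n−1}² ≤ q³B + 4`, dump `≤ 9/5`), the front
pair satisfies the conclusions of `stub_incubation` read in real time (`Φ₁ = 2`, `θ₀ = 1/10`,
`μ₀ = 2B`, `μ₁ = Fε̄B`): positivity of the bond, the carrier envelope, the majorant bounds
(the carrier majorant from its Duhamel restart inequality), the transfer budget
`R_n ∫ w_n² ≤ 1/100` and the two ignition-budget inequalities. Registered tools sub-goal
`preBoot_front` of the stub `preBoot`. [folklore] -/
theorem preBoot_front :
    ∀ (ε₀ D εb θ η F blo bhi q T t₀ S B : ℝ) (n₀ n : ℤ) (bv wv M0 M1 db dw G0 G1 : ℤ → ℝ → ℝ)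
      (R : ℤ → ℝ),
      (q = Real.sqrt (1 + ε₀)) →
      (∀ k : ℤ, R k = D * (1 + ε₀) ^ (2 * k)) →
      (∀ (k : ℤ) (t : ℝ), G0 k t = (wv (k - 1) t) ^ 2 / q ^ 3 - (wv k t) ^ 2 - εb * bv k t * wv k t) →
      (∀ (k : ℤ) (t : ℝ), G1 k t = wv k t * (bv k t - bv (k + 1) t / q) + εb * (bv k t) ^ 2) →
      (0 < ε₀) →
      (ε₀ ≤ 1 / 20) →
      (0 < D) →
      (1 / 2 ≤ θ) →
      (θ ≤ 1) →
      (0 ≤ η) →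
      (0 < εb) →
      (εb ≤ 1 / 10 ^ 6) →
      (10 ^ 4 + 40 - 5 * Real.log εb ≤ blo) →
      (10 ^ 9 * (bhi + 4) ^ 4 ≤ F) →
      (η * (10 ^ 9 * (bhi + 4) ^ 4 * (F + 1)) ≤ 1) →
      (εb * (10 ^ 9 * (F + 1) ^ 2 * (bhi + 4) ^ 3) ≤ 1) →
      (blo ≤ B) →
      (B ≤ bhi) →
      (∀ k : ℤ, k < n₀ → ∀ t ∈ Icc 0 T, bv k t = 0 ∧ wv k t = 0 ∧ M0 k t = 0 ∧ M1 k t = 0) →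
      (∀ k : ℤ, ContinuousOn (bv k) (Icc 0 T) ∧ ContinuousOn (wv k) (Icc 0 T) ∧
        ContinuousOn (M0 k) (Icc 0 T) ∧ ContinuousOn (M1 k) (Icc 0 T)) →
      (∀ k : ℤ, ContinuousOn (db k) (Icc 0 T) ∧ ContinuousOn (dw k) (Icc 0 T) ∧
        ∀ t ∈ Ioo 0 T, HasDerivAt (bv k) (db k t) t ∧
        |db k t - R k * (-(bv k t) + G0 k t)| ≤ η * R k * M0 k t ∧
        HasDerivAt (wv k) (dw k t) t ∧ |dw k t - R k * (-(wv k t) + G1 k t)| ≤ η * R k * M1 k t) →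
      (∀ k : ℤ, ∀ t ∈ Icc 0 T, |bv k t| ≤ M0 k t ∧ |wv k t| ≤ M1 k t ∧ 0 ≤ M0 k t ∧ 0 ≤ M1 k t) →
      (∀ k : ℤ, ∀ t₁ ∈ Icc 0 T, ∀ t₂ ∈ Icc t₁ T,
        M0 k t₂ ≤ M0 k t₁ * Real.exp (-(θ * R k * (t₂ - t₁))) +
        R k * ∫ u in t₁..t₂, Real.exp (-(θ * R k * (t₂ - u))) * |G0 k u| ∧
        M1 k t₂ ≤ M1 k t₁ * Real.exp (-(θ * R k * (t₂ - t₁))) +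
        R k * ∫ u in t₁..t₂, Real.exp (-(θ * R k * (t₂ - u))) * |G1 k u|) →
      (0 < T) →
      (0 ≤ t₀) →
      (t₀ < S) →
      (S ≤ T) →
      (R n * (S - t₀) ≤ 3) →
      (bv n t₀ = B ∧ 0 ≤ wv n t₀ ∧ wv n t₀ ≤ F * εb * B ∧ M1 n t₀ ≤ F * εb * B ∧
        M0 n t₀ ≤ 2 * B) →
      (∀ u ∈ Icc t₀ S, (wv n u) ^ 2 ≤ bv n u / 100) →
      (∀ u ∈ Icc t₀ S, |bv (n + 1) u| ≤ 1 / 2) →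
      (n₀ ≤ n - 1 → ∀ u ∈ Icc t₀ S, (wv (n - 1) u) ^ 2 ≤ q ^ 3 * B + 4 ∧
        (1 + ε₀) ^ (-(2 : ℤ)) * R n * ∫ t in t₀..u, (wv (n - 1) t) ^ 2 ≤ 9 / 5) →
      (∀ u ∈ Ioc t₀ S, 0 < wv n u) ∧
      (∀ u ∈ Icc t₀ S, B * Real.exp (-(R n * (u - t₀))) - 3 / 2 ≤ bv n u ∧
      bv n u ≤ B * Real.exp (-(R n * (u - t₀))) + 5 / 2 ∧ 0 ≤ wv n u ∧ M0 n u ≤ 6 * (B + 3) ∧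
      M1 n u ≤ F * εb * B + 2 * wv n u + 2 * εb * (B + 3) ^ 2 * (R n * (u - t₀))) ∧
      R n * ∫ t in t₀..S, (wv n t) ^ 2 ≤ 1 / 100 ∧
      B * (1 - Real.exp (-(R n * (S - t₀)))) ≤
      max 0 (Real.log (6 / 10 * Real.sqrt (B + 4) / (εb * B))) + 6 * (R n * (S - t₀) + 1) + 2 ∧
      (bv n S / 100 ≤ (wv n S) ^ 2 →
      bv n S ≤ B + Real.log (10 * (F + 2) * εb * B) + 6 * (R n * (S - t₀) + 1)) := by
  intro ε₀ D εb θ η F blo bhi q T t₀ S B n₀ n bv wv M0 M1 db dw G0 G1 R hq hR hG0 hG1 hε₀ hε₀' hD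
    hθ hθ1 hη hεb hεb6 hblo hF hηreg hεbreg hBlo hBhi hzero hcont hC1 hmaj hrest hT ht₀ hS hST hS3
    hInvF hnoig hL1 hLPd
  obtain ⟨hεb1, hB4, hB1, hF0, hFεB, hεbhi, hq1, hq21⟩ :=
    oneStepCore_regime hε₀ hε₀' hεb hεb6 hblo hF hεbreg hBlo hBhi hq
  have hbhi : 1 ≤ bhi + 4 := by linarith
  obtain ⟨hRpos, hRkk, -, -, -, -, -, -, hκq, hq0, hq2⟩ := preBoot_rates hε₀ hε₀' hD hR hq n
  have hRn := hRpos n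
  have hθ0 : 0 < θ := by linarith
  obtain ⟨hη9, hη1, -, -, hη3F, -⟩ := preBoot_eta hη hF0 hbhi hηreg
  obtain ⟨hb0, hW0, hWF, hM10, hM00⟩ := hInvF
  -- slow time of the front
  set S' := R n * (S - t₀) with hS'
  have hS'0 : 0 < S' := mul_pos hRn (by linarith)
  have hST' : t₀ + S' / R n ≤ T := by
    rw [hS', mul_div_cancel_left₀ _ hRn.ne']
    linarith
  obtain ⟨⟨hbc, hm0c, hg0c, he0c, hdb, he0, hm0D⟩, ⟨hwc, hm1c, -, he1c, hdw, he1, hm1D⟩⟩ :=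
    handoff_sysPkg (k := n) hG0 hG1 hcont hC1 hmaj hrest hRn hT ht₀ hS'0.le hST'
  obtain ⟨-, ⟨hwlc, -⟩⟩ :=
    handoff_sysPkg (k := n - 1) hG0 hG1 hcont hC1 hmaj hrest hRn hT ht₀ hS'0.le hST'
  obtain ⟨⟨hbpc, -⟩, -⟩ :=
    handoff_sysPkg (k := n + 1) hG0 hG1 hcont hC1 hmaj hrest hRn hT ht₀ hS'0.le hST'
  obtain ⟨hmem, hpush⟩ := preBoot_push (tb := t₀) (s₁ := S) hRn
  obtain ⟨htime1, htime, ht00⟩ := preBoot_time (tb := t₀) hRn.ne'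
  have hdsq : ∀ a : ℝ, (a / (q * Real.sqrt q)) ^ 2 = a ^ 2 / q ^ 3 := fun a => (preBoot_divsq hq1 a).1
  -- the forcings of the front pair
  have hG0n : ∀ t, G0 n t =
      -(wv n t) ^ 2 + (wv (n - 1) t / (q * Real.sqrt q)) ^ 2 - εb * bv n t * wv n t := by
    intro t
    rw [hG0, hdsq]
    ring
  have hG1n : ∀ t, G1 n t =
      wv n t * ((bv n t - bv (n + 1) t / q - 1) + 1) + εb * (bv n t) ^ 2 := by
    intro t
    rw [hG1]
    ring
  -- regime side conditions of `stub_incubation`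
  have hημ₀ : η * (2 * B) ≤ 1 / 10 := by
    have : η * B ≤ η * (bhi + 4) := mul_le_mul_of_nonneg_left (by linarith) hη
    linarith
  have hημ₁ : η * (F * εb * B) ≤ εb := by
    have h1 : F * B ≤ (bhi + 4) ^ 3 * (F + 1) :=
      calc F * B ≤ (F + 1) * (bhi + 4) :=
            mul_le_mul (by linarith) (by linarith) (by linarith) (by linarith)
        _ ≤ (bhi + 4) ^ 2 * ((F + 1) * (bhi + 4)) :=
            le_mul_of_one_le_left (by positivity) (one_le_pow₀ hbhi)
        _ = (bhi + 4) ^ 3 * (F + 1) := by ring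
    have h2 : η * (F * B) ≤ 1 / 10 ^ 9 := le_trans (mul_le_mul_of_nonneg_left h1 hη) hη3F
    calc η * (F * εb * B) = εb * (η * (F * B)) := by ring
      _ ≤ εb * (1 / 10 ^ 9) := mul_le_mul_of_nonneg_left h2 hεb.le
      _ ≤ εb := by linarith
  have hηT : η * Real.exp (2 * S') ≤ 1 / 1000 := by
    have h6 : Real.exp (2 * S') ≤ 405 :=
      le_trans (Real.exp_le_exp.2 (by linarith)) preBoot_exp_six.le
    nlinarith [Real.exp_pos (2 * S')]
  have hW0sq : wv n t₀ ^ 2 < (1 / 10) ^ 2 * B := by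
    have := oneStepCore_w0_sq_lt hεb hF0 hB1 hBhi hεbreg hW0 hWF
    linarith
  have hexp3 : 1 / 21 ≤ Real.exp (-S') := by
    have h1 : Real.exp (-3) ≤ Real.exp (-S') := Real.exp_le_exp.2 (by linarith)
    have h2 : 1 / 21 ≤ Real.exp (-3) := by
      rw [Real.exp_neg, one_div, inv_le_inv₀ (by norm_num) (Real.exp_pos 3)]
      exact preBoot_exp_three.le
    linarith
  have hB0 : 0 ≤ B := by linarith
  have hBT : 20 ≤ B * Real.exp (-S') := by
    have := mul_le_mul_of_nonneg_left hexp3 hB0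
    linarith
  -- no ignition, the loose level-1 carrier, the previous bond in slow time
  have hpre : ∀ σ ∈ Icc 0 S', (wv n (t₀ + σ / R n)) ^ 2 ≤ (1 / 10) ^ 2 * bv n (t₀ + σ / R n) := by
    intro σ hσ
    have := hnoig _ (hmem σ hσ)
    linarith
  have hγ : ∀ σ ∈ Icc 0 S',
      bv n (t₀ + σ / R n) - 2 ≤ bv n (t₀ + σ / R n) - bv (n + 1) (t₀ + σ / R n) / q - 1 ∧
      bv n (t₀ + σ / R n) - bv (n + 1) (t₀ + σ / R n) / q - 1 ≤ bv n (t₀ + σ / R n) := by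
    intro σ hσ
    have h := abs_le.1 ((preBoot_div_q hq1).2 _ _ (hL1 _ (hmem σ hσ)))
    constructor <;> linarith [h.1, h.2]
  have hwlsq : ∀ u ∈ Icc t₀ S, (wv (n - 1) u) ^ 2 ≤ q ^ 3 * B + 4 := by
    intro u hu
    by_cases h1 : n₀ ≤ n - 1
    · exact (hLPd h1 u hu).1
    · rw [(hzero (n - 1) (by omega) u ⟨ht₀.trans hu.1, hu.2.trans hST⟩).2.1]
      have := mul_nonneg (pow_nonneg hq0.le 3) hB0
      linarith
  have hdump : ∀ u ∈ Icc t₀ S, R n * ∫ t in t₀..u, (wv (n - 1) t) ^ 2 ≤ 9 / 5 * q ^ 4 := by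
    intro u hu
    by_cases h1 : n₀ ≤ n - 1
    · have h := (hLPd h1 u hu).2
      have hq4 : 0 ≤ q ^ 4 := by positivity
      calc R n * ∫ t in t₀..u, (wv (n - 1) t) ^ 2
          = q ^ 4 * ((1 + ε₀) ^ (-(2 : ℤ)) * R n * ∫ t in t₀..u, (wv (n - 1) t) ^ 2) := by
            rw [← mul_assoc, ← mul_assoc, mul_comm (q ^ 4), hκq, one_mul]
        _ ≤ q ^ 4 * (9 / 5) := mul_le_mul_of_nonneg_left h hq4
        _ = 9 / 5 * q ^ 4 := by ring
    · have h0 : ∫ t in t₀..u, (wv (n - 1) t) ^ 2 = ∫ _ in t₀..u, (0 : ℝ) := by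
        refine intervalIntegral.integral_congr fun t ht => ?_
        rw [uIcc_of_le hu.1] at ht
        simp [(hzero (n - 1) (by omega) t ⟨ht₀.trans ht.1, ht.2.trans (hu.2.trans hST)⟩).2.1]
      rw [h0, intervalIntegral.integral_zero, mul_zero]
      positivity
  have hwlΦ : ∀ σ ∈ Icc 0 S',
      ∫ u in (0 : ℝ)..σ, (wv (n - 1) (t₀ + u / R n) / (q * Real.sqrt q)) ^ 2 ≤ 2 := by
    intro σ hσ
    simp only [hdsq]
    rw [intervalIntegral.integral_div, div_le_iff₀ (by positivity),
      ← integral_rescale (fun t => (wv (n - 1) t) ^ 2) hRn.ne' 0 σ,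
      intervalIntegral.integral_const_mul, ht00]
    have h := hdump _ (hmem σ hσ)
    have h' : 9 / 5 * q ^ 4 ≤ 2 * q ^ 3 :=
      calc 9 / 5 * q ^ 4 = 9 / 5 * q * q ^ 3 := by ring
        _ ≤ 2 * q ^ 3 := mul_le_mul_of_nonneg_right (by linarith) (pow_pos hq0 3).le
    linarith
  -- hypotheses of `stub_incubation`
  have h1 : ContinuousOn (fun σ => bv n (t₀ + σ / R n) - bv (n + 1) (t₀ + σ / R n) / q - 1)
      (Icc 0 S') := (hbc.sub (hbpc.div_const _)).sub continuousOn_const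
  have h2 : ∀ σ ∈ Ioo 0 S', HasDerivAt (fun s => bv n (t₀ + s / R n))
      (-(bv n (t₀ + σ / R n)) - (wv n (t₀ + σ / R n)) ^ 2 +
        (wv (n - 1) (t₀ + σ / R n) / (q * Real.sqrt q)) ^ 2 -
        εb * bv n (t₀ + σ / R n) * wv n (t₀ + σ / R n) +
        (db n (t₀ + σ / R n) - R n * (-(bv n (t₀ + σ / R n)) + G0 n (t₀ + σ / R n))) / R n) σ := by
    intro σ hσ
    refine (hdb σ hσ).congr_deriv ?_
    rw [hRkk, hG0n]
    ring
  have h3 : ∀ σ ∈ Ioo 0 S', HasDerivAt (fun s => wv n (t₀ + s / R n))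
      (wv n (t₀ + σ / R n) * (bv n (t₀ + σ / R n) - bv (n + 1) (t₀ + σ / R n) / q - 1) +
        εb * (bv n (t₀ + σ / R n)) ^ 2 +
        (dw n (t₀ + σ / R n) - R n * (-(wv n (t₀ + σ / R n)) + G1 n (t₀ + σ / R n))) / R n) σ := by
    intro σ hσ
    refine (hdw σ hσ).congr_deriv ?_
    rw [hRkk, hG1]
    ring
  have h4 : ∀ σ ∈ Icc 0 S',
      |(db n (t₀ + σ / R n) - R n * (-(bv n (t₀ + σ / R n)) + G0 n (t₀ + σ / R n))) / R n| ≤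
        η * M0 n (t₀ + σ / R n) := by
    intro σ hσ
    have := he0 σ hσ
    rwa [hRkk, mul_one] at this
  have h5 : ∀ σ ∈ Icc 0 S',
      |(dw n (t₀ + σ / R n) - R n * (-(wv n (t₀ + σ / R n)) + G1 n (t₀ + σ / R n))) / R n| ≤
        η * M1 n (t₀ + σ / R n) := by
    intro σ hσ
    have := he1 σ hσ
    rwa [hRkk, mul_one] at this
  have h6 : ∀ σ ∈ Icc 0 S', 0 ≤ M0 n (t₀ + σ / R n) ∧
      M0 n (t₀ + σ / R n) ≤ M0 n (t₀ + 0 / R n) * Real.exp (-(θ * σ)) +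
        ∫ u in (0 : ℝ)..σ, Real.exp (-(θ * (σ - u))) *
          |-(wv n (t₀ + u / R n)) ^ 2 + (wv (n - 1) (t₀ + u / R n) / (q * Real.sqrt q)) ^ 2 -
            εb * bv n (t₀ + u / R n) * wv n (t₀ + u / R n)| := by
    intro σ hσ
    have := hm0D σ hσ
    simp only [hRkk, mul_one, one_mul, hG0n] at this
    exact this
  have h7 : ∀ σ ∈ Icc 0 S', 0 ≤ M1 n (t₀ + σ / R n) ∧
      M1 n (t₀ + σ / R n) ≤ M1 n (t₀ + 0 / R n) * Real.exp (-(θ * σ)) +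
        ∫ u in (0 : ℝ)..σ, Real.exp (-(θ * (σ - u))) *
          |wv n (t₀ + u / R n) * ((bv n (t₀ + u / R n) - bv (n + 1) (t₀ + u / R n) / q - 1) + 1) +
            εb * (bv n (t₀ + u / R n)) ^ 2| := by
    intro σ hσ
    have := hm1D σ hσ
    simp only [hRkk, mul_one, one_mul, hG1n] at this
    exact this
  obtain ⟨kpos, kenv, kint, kM1, kN1, kN2⟩ := stub_incubation (fun σ => bv n (t₀ + σ / R n))
    (fun σ => wv n (t₀ + σ / R n))
    (fun σ => bv n (t₀ + σ / R n) - bv (n + 1) (t₀ + σ / R n) / q - 1)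
    (fun σ => wv (n - 1) (t₀ + σ / R n) / (q * Real.sqrt q)) (fun σ => M0 n (t₀ + σ / R n))
    (fun σ => M1 n (t₀ + σ / R n))
    (fun σ => (db n (t₀ + σ / R n) - R n * (-(bv n (t₀ + σ / R n)) + G0 n (t₀ + σ / R n))) / R n)
    (fun σ => (dw n (t₀ + σ / R n) - R n * (-(wv n (t₀ + σ / R n)) + G1 n (t₀ + σ / R n))) / R n)
    B (wv n t₀) εb (1 / 10) θ η (2 * B) (F * εb * B) 2 S' hεb hεb6 (by norm_num) (by norm_num) hθ
    hθ1 hη (by linarith) (by linarith) hημ₀ (by positivity) hημ₁ hηT (by norm_num) le_rfl hS'0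
    (by linarith) hW0 hW0sq hBT hbc hwc h1 (hwlc.div_const _) hm0c hm1c he0c he1c h2 h3 hγ h4
    h5 h6 h7 hwlΦ
    (by rw [ht00]; exact hb0) (by rw [ht00]) (by rw [ht00]; exact hM00) (by rw [ht00]; exact hM10)
    hpre
  -- the carrier majorant from the Duhamel restart inequality
  have henv' : ∀ σ ∈ Icc 0 S', 0 ≤ bv n (t₀ + σ / R n) ∧ bv n (t₀ + σ / R n) ≤ B + 3 := by
    intro σ hσ
    obtain ⟨k1, k2⟩ := kenv σ hσ
    have he1 : B * Real.exp (-σ) ≤ B :=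
      mul_le_of_le_one_right hB0 (Real.exp_le_one_iff.2 (by linarith [hσ.1]))
    have he2 : B * Real.exp (-S') ≤ B * Real.exp (-σ) :=
      mul_le_mul_of_nonneg_left (Real.exp_le_exp.2 (by linarith [hσ.2])) hB0
    constructor <;> linarith
  have hwnn : ∀ σ ∈ Icc 0 S', 0 ≤ wv n (t₀ + σ / R n) := by
    intro σ hσ
    rcases hσ.1.eq_or_lt with h | h
    · rw [← h, ht00]
      exact hW0
    · exact (kpos σ ⟨h, hσ.2⟩).le
  have hM0 : ∀ σ ∈ Icc 0 S', M0 n (t₀ + σ / R n) ≤ 6 * (B + 3) := by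
    intro σ hσ
    have hsub : Icc 0 σ ⊆ Icc 0 S' := Icc_subset_Icc_right hσ.2
    have hgc : ContinuousOn (fun u => -(wv n (t₀ + u / R n)) ^ 2 +
        (wv (n - 1) (t₀ + u / R n) / (q * Real.sqrt q)) ^ 2 -
        εb * bv n (t₀ + u / R n) * wv n (t₀ + u / R n)) (Icc 0 σ) :=
      (hg0c.mono hsub).congr fun u _ => (hG0n _).symm
    have hgC : ∀ u ∈ Icc 0 σ, |-(wv n (t₀ + u / R n)) ^ 2 +
        (wv (n - 1) (t₀ + u / R n) / (q * Real.sqrt q)) ^ 2 -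
        εb * bv n (t₀ + u / R n) * wv n (t₀ + u / R n)| ≤ 13 / 10 * B + 6 := by
      intro u hu
      have hu' : u ∈ Icc 0 S' := hsub hu
      obtain ⟨hb0', hb3⟩ := henv' u hu'
      have hw0' := hwnn u hu'
      have hw2 := hpre u hu'
      have hwl2 : (wv (n - 1) (t₀ + u / R n) / (q * Real.sqrt q)) ^ 2 ≤ q ^ 3 * B + 4 := by
        rw [hdsq]
        exact (div_le_self (sq_nonneg _) (one_le_pow₀ hq1)).trans (hwlsq _ (hmem u hu'))
      have hq3 : q ^ 3 * B ≤ 1158 / 1000 * B := by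
        refine mul_le_mul_of_nonneg_right ?_ hB0
        have := pow_le_pow_left₀ hq0.le hq21 3
        linarith [show ((21 : ℝ) / 20) ^ 3 ≤ 1158 / 1000 by norm_num]
      have hwB : wv n (t₀ + u / R n) ≤ B + 3 := by
        have h1 : (wv n (t₀ + u / R n)) ^ 2 ≤ (B + 3) ^ 2 :=
          calc (wv n (t₀ + u / R n)) ^ 2 ≤ (1 / 10) ^ 2 * bv n (t₀ + u / R n) := hw2
            _ ≤ B + 3 := by linarith
            _ ≤ (B + 3) ^ 2 := le_self_pow₀ (by linarith) two_ne_zero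
        exact (le_abs_self _).trans (abs_le_of_sq_le_sq h1 (by linarith))
      have hbw : εb * bv n (t₀ + u / R n) * wv n (t₀ + u / R n) ≤ 1 := by
        have h1 : εb * bv n (t₀ + u / R n) * wv n (t₀ + u / R n) ≤ εb * (B + 3) * (B + 3) := by
          have h1 : εb * bv n (t₀ + u / R n) ≤ εb * (B + 3) :=
            mul_le_mul_of_nonneg_left hb3 hεb.le
          exact mul_le_mul h1 hwB hw0' (mul_nonneg hεb.le (by linarith))
        have h2 : εb * (B + 3) * (B + 3) ≤ εb * (bhi + 4) ^ 2 := by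
          rw [mul_assoc, ← sq]
          exact mul_le_mul_of_nonneg_left (pow_le_pow_left₀ (by linarith) (by linarith) 2) hεb.le
        linarith
      have hbw0 : 0 ≤ εb * bv n (t₀ + u / R n) * wv n (t₀ + u / R n) := by positivity
      have hsq0 := sq_nonneg (wv (n - 1) (t₀ + u / R n) / (q * Real.sqrt q))
      have hsq1 := sq_nonneg (wv n (t₀ + u / R n))
      rw [abs_le]
      constructor <;> linarith
    have hm := trailPair_majorant_le hθ0 (by positivity) hσ.1 hgc hgC
      (show M0 n (t₀ + 0 / R n) ≤ 2 * B by rw [ht00]; exact hM00) (h6 σ hσ).2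
    have he : 2 * B * Real.exp (-(θ * σ)) ≤ 2 * B :=
      mul_le_of_le_one_right (by linarith) (Real.exp_le_one_iff.2 (by
        have := mul_nonneg hθ0.le hσ.1
        linarith))
    have hC : (13 / 10 * B + 6) / θ ≤ 2 * (13 / 10 * B + 6) := by
      rw [div_le_iff₀ hθ0]
      have := mul_le_mul_of_nonneg_left hθ (by linarith : (0 : ℝ) ≤ 13 / 10 * B + 6)
      linarith
    linarith
  refine ⟨(preBoot_pull hRn).2 kpos, (preBoot_pull (P := fun s =>
      B * Real.exp (-(R n * (s - t₀))) - 3 / 2 ≤ bv n s ∧ bv n s ≤ B * Real.exp (-(R n * (s - t₀))) + 5 / 2 ∧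
      0 ≤ wv n s ∧ M0 n s ≤ 6 * (B + 3) ∧
      M1 n s ≤ F * εb * B + 2 * wv n s + 2 * εb * (B + 3) ^ 2 * (R n * (s - t₀))) hRn).1
      (fun σ hσ => ?_), ?_, ?_, fun hig => ?_⟩
  · rw [htime]
    obtain ⟨k1, k2⟩ := kenv σ hσ
    exact ⟨k1, by linarith, hwnn σ hσ, hM0 σ hσ, kM1 σ hσ⟩
  · -- the transfer budget
    have e1 : ∫ u in (0 : ℝ)..S', (wv n (t₀ + u / R n)) ^ 2 =
        R n * ∫ t in t₀..S, (wv n t) ^ 2 := by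
      rw [← integral_rescale (fun t => (wv n t) ^ 2) hRn.ne' 0 S',
        intervalIntegral.integral_const_mul, ht00, hS', htime1]
    have := kint
    rw [e1] at this
    linarith
  · have e : (6 : ℝ) * (1 / 10) * Real.sqrt (B + 4) = 6 / 10 * Real.sqrt (B + 4) := by ring
    rw [e] at kN1
    exact kN1
  · have hS'' : t₀ + S' / R n = S := by rw [hS', htime1]
    have hig' : (1 / 10) ^ 2 * bv n (t₀ + S' / R n) ≤ (wv n (t₀ + S' / R n)) ^ 2 := by
      rw [hS'']
      linarith
    have k := kN2 hig'
    rw [hS''] at k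
    have hden : 0 < wv n t₀ + 2 * εb * B := by positivity
    have hlog : -Real.log (1 / 10 / (wv n t₀ + 2 * εb * B)) ≤ Real.log (10 * (F + 2) * εb * B) := by
      rw [← Real.log_inv, inv_div]
      refine Real.log_le_log (by positivity) ?_
      rw [div_le_iff₀ (by norm_num : (0 : ℝ) < 1 / 10)]
      linarith
    linarith

end Summit.NavierStokesRegularity.NavierStokesRegularity.Theorems.PerpetualPumpAveragedTypeIBlowup

end
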